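import Summits.Ventures.Crystal3D.Theorems.StickyWulffConstantNoReconstructionGainExactCriminalHeavy
import HarnessLib

/-!
# `K₆` minus two disjoint edges is not a contact graph of unit balls in `ℝ³` (criminal anatomy brick, line `replication-exactness`)

HONEST FRAMING. Part of the venture `Summits/Ventures/Crystal3D` (cell `crystal3d-full`), helper `--supports` the
crux `NoReconstructionGain` (stmt-Ventures-19144, route `route-Ventures-StickyWulffConstant`), lead wulff-p1 g19.
Elementary geometry for the anatomy of a minimal criminal (`#Q_off ≥ 10`, next file): the second forbidden
contact pattern after `K₅` (`no_five_pairwise_dist_two`).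

* `inner_eq_half_of_unit_triangle` — bookkeeping: `‖B‖ = ‖A‖ = ‖B − A‖ = 1 ⟹ ⟪A, B⟫ = 1/2`.
* `inner_eq_one_or_eq_neg_third` — if `A, B, C, B'` are unit vectors of `ℝ³` with `⟪A,B⟫ = ⟪A,C⟫ = ⟪A,B'⟫ =
  ⟪B,C⟫ = ⟪B',C⟫ = 1/2`, then `⟪B, B'⟫ ∈ {1, −1/3}` (the Gram determinant `¼ + β/2 − ¾β²` of four vectors of
  `ℝ³` vanishes; proved as: otherwise the four vectors are linearly independent, `4 ≤ finrank = 3`).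
* `no_K1122_contacts` — **there are no six points `u, a, b, b', c, c'` of `ℝ³` with `b ≠ b'`, `c ≠ c'` and the
  thirteen unit distances `ua, ub, ub', uc, uc', ab, ab', ac, ac', bc, bc', b'c, b'c'`** (the graph `K_{1,1,2,2}` =
  `K₆` minus the two disjoint edges `bb'`, `cc'`).  Geometric content: the common neighbours of the touching pair
  `u, a` lie on a circle of radius `√3/2` on which a unit chord subtends `arccos(1/3) ≈ 70.5°`, so four of them
  cannot close a 4-cycle of unit chords (`4 · 70.5° ≠ 360°`); algebraically `⟪b−u, b'−u⟫ = ⟪c−u, c'−u⟫ = −1/3`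
  forces `‖(b−u)+(b'−u)−(c−u)−(c'−u)‖² = −4/3`.

WHAT THIS IS NOT: nothing about films or the crux by itself; rung F-C1 not moved.
-/

noncomputable section

namespace Summit.Ventures.Crystal3D.Theorems

open scoped InnerProductSpace

/-- `‖A‖ = ‖B‖ = ‖B − A‖ = 1 ⟹ ⟪A, B⟫ = 1/2`. -/
theorem inner_eq_half_of_unit_triangle {A B : EuclideanSpace ℝ (Fin 3)} (hA : ‖A‖ = 1) (hB : ‖B‖ = 1)
    (hAB : ‖B - A‖ = 1) : ⟪A, B⟫_ℝ = 1 / 2 := by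
  have e := norm_sub_sq_real B A
  rw [hAB, hA, hB, real_inner_comm] at e
  linarith

/-- Four unit vectors `A, B, C, B'` of `ℝ³` with `⟪A,B⟫ = ⟪A,C⟫ = ⟪A,B'⟫ = ⟪B,C⟫ = ⟪B',C⟫ = 1/2` have
`⟪B, B'⟫ = 1` or `⟪B, B'⟫ = −1/3` (vanishing of the Gram determinant in dimension three). -/
theorem inner_eq_one_or_eq_neg_third {A B C B' : EuclideanSpace ℝ (Fin 3)}
    (hA : ‖A‖ = 1) (hB : ‖B‖ = 1) (hC : ‖C‖ = 1) (hB' : ‖B'‖ = 1)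
    (hAB : ⟪A, B⟫_ℝ = 1 / 2) (hAC : ⟪A, C⟫_ℝ = 1 / 2) (hAB' : ⟪A, B'⟫_ℝ = 1 / 2)
    (hBC : ⟪B, C⟫_ℝ = 1 / 2) (hB'C : ⟪B', C⟫_ℝ = 1 / 2) :
    ⟪B, B'⟫_ℝ = 1 ∨ ⟪B, B'⟫_ℝ = -1 / 3 := by
  by_contra hne
  push Not at hne
  obtain ⟨h1, h3⟩ := hne
  set β : ℝ := ⟪B, B'⟫_ℝ with hβ
  set w : Fin 4 → EuclideanSpace ℝ (Fin 3) := ![A, C, B, B'] with hw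
  have hAA : ⟪A, A⟫_ℝ = 1 := by rw [real_inner_self_eq_norm_sq, hA]; norm_num
  have hBB : ⟪B, B⟫_ℝ = 1 := by rw [real_inner_self_eq_norm_sq, hB]; norm_num
  have hCC : ⟪C, C⟫_ℝ = 1 := by rw [real_inner_self_eq_norm_sq, hC]; norm_num
  have hB'B' : ⟪B', B'⟫_ℝ = 1 := by rw [real_inner_self_eq_norm_sq, hB']; norm_num
  have hli : LinearIndependent ℝ w := by
    rw [Fintype.linearIndependent_iff]
    intro g hg
    have key : ∀ v, ⟪∑ i, g i • w i, v⟫_ℝ = 0 := fun v => by rw [hg, inner_zero_left]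
    have e : ∀ v, ⟪∑ i, g i • w i, v⟫_ℝ = ∑ i, g i * ⟪w i, v⟫_ℝ := fun v => by
      rw [sum_inner]; simp [real_inner_smul_left]
    have kA := key A; have kC := key C; have kB := key B; have kB' := key B'
    rw [e] at kA kC kB kB'
    simp only [Fin.sum_univ_four, hw, Matrix.cons_val_zero, Matrix.cons_val_one, Matrix.cons_val]
      at kA kC kB kB'
    have hCA : ⟪C, A⟫_ℝ = 1 / 2 := by rw [real_inner_comm]; exact hAC
    have hBA : ⟪B, A⟫_ℝ = 1 / 2 := by rw [real_inner_comm]; exact hAB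
    have hB'A : ⟪B', A⟫_ℝ = 1 / 2 := by rw [real_inner_comm]; exact hAB'
    have hCB : ⟪C, B⟫_ℝ = 1 / 2 := by rw [real_inner_comm]; exact hBC
    have hCB' : ⟪C, B'⟫_ℝ = 1 / 2 := by rw [real_inner_comm]; exact hB'C
    have hB'B : ⟪B', B⟫_ℝ = β := by rw [hβ, real_inner_comm]
    have hBB'' : ⟪B, B'⟫_ℝ = β := hβ.symm
    simp only [hAA, hCA, hBA, hB'A, hAC, hCC, hBC, hB'C, hAB, hCB, hBB, hB'B, hAB', hCB', hBB'', hB'B']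
      at kA kC kB kB'
    -- solve the 4×4 system with parameter β ∉ {1, −1/3}
    have e01 : g 0 = g 1 := by linarith
    have e23 : g 2 + g 3 = -3 * g 0 := by linarith
    have e0 : g 0 * (-1 - 3 * β) = 0 := by
      have hsum : (g 0 + g 1) + (g 2 + g 3) + β * (g 2 + g 3) = 0 := by linear_combination kB + kB'
      rw [e23, ← e01] at hsum
      linear_combination hsum
    have hβ3 : (-1 - 3 * β) ≠ 0 := by
      intro h; apply h3; linarith
    have g0 : g 0 = 0 := by
      rcases mul_eq_zero.1 e0 with h | h
      · exact h
      · exact absurd h hβ3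
    have e23' : (g 2 - g 3) * (1 - β) = 0 := by linear_combination kB - kB'
    have hβ1 : (1 - β) ≠ 0 := by intro h; apply h1; linarith
    have g23 : g 2 = g 3 := by
      rcases mul_eq_zero.1 e23' with h | h
      · linarith
      · exact absurd h hβ1
    intro i
    fin_cases i <;> simp <;> linarith
  have hcard := hli.fintype_card_le_finrank
  rw [finrank_euclideanSpace_fin, Fintype.card_fin] at hcard
  omega

/-- **`K_{1,1,2,2}` (= `K₆` minus two disjoint edges) is not a contact graph of unit balls in `ℝ³`.** -/
theorem no_K1122_contacts (u a b b' c c' : EuclideanSpace ℝ (Fin 3)) (hbb' : b ≠ b') (hcc' : c ≠ c')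
    (hua : dist u a = 1) (hub : dist u b = 1) (hub' : dist u b' = 1) (huc : dist u c = 1)
    (huc' : dist u c' = 1) (hab : dist a b = 1) (hab' : dist a b' = 1) (hac : dist a c = 1)
    (hac' : dist a c' = 1) (hbc : dist b c = 1) (hbc' : dist b c' = 1) (hb'c : dist b' c = 1)
    (hb'c' : dist b' c' = 1) : False := by
  set A := a - u with hAd
  set B := b - u with hBd
  set B' := b' - u with hB'd
  set C := c - u with hCd
  set C' := c' - u with hC'd
  have nrm : ∀ {p : EuclideanSpace ℝ (Fin 3)}, dist u p = 1 → ‖p - u‖ = 1 := by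
    intro p h; rwa [← dist_eq_norm, dist_comm]
  have hA : ‖A‖ = 1 := nrm hua
  have hB : ‖B‖ = 1 := nrm hub
  have hB' : ‖B'‖ = 1 := nrm hub'
  have hC : ‖C‖ = 1 := nrm huc
  have hC' : ‖C'‖ = 1 := nrm huc'
  have sub : ∀ p q : EuclideanSpace ℝ (Fin 3), (q - u) - (p - u) = q - p := fun p q => by abel
  have tri : ∀ {p q : EuclideanSpace ℝ (Fin 3)}, dist p q = 1 → ‖p - u‖ = 1 → ‖q - u‖ = 1 →
      ⟪p - u, q - u⟫_ℝ = 1 / 2 := by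
    intro p q h hp hq
    refine inner_eq_half_of_unit_triangle hp hq ?_
    rw [sub, ← dist_eq_norm, dist_comm, h]
  have hAB : ⟪A, B⟫_ℝ = 1 / 2 := tri hab hA hB
  have hAB' : ⟪A, B'⟫_ℝ = 1 / 2 := tri hab' hA hB'
  have hAC : ⟪A, C⟫_ℝ = 1 / 2 := tri hac hA hC
  have hAC' : ⟪A, C'⟫_ℝ = 1 / 2 := tri hac' hA hC'
  have hBC : ⟪B, C⟫_ℝ = 1 / 2 := tri hbc hB hC
  have hBC' : ⟪B, C'⟫_ℝ = 1 / 2 := tri hbc' hB hC'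
  have hB'C : ⟪B', C⟫_ℝ = 1 / 2 := tri hb'c hB' hC
  have hB'C' : ⟪B', C'⟫_ℝ = 1 / 2 := tri hb'c' hB' hC'
  -- β = ⟪B,B'⟫ and γ = ⟪C,C'⟫ are `−1/3`
  have hβ : ⟪B, B'⟫_ℝ = -1 / 3 := by
    rcases inner_eq_one_or_eq_neg_third hA hB hC hB' hAB hAC hAB' hBC hB'C with h | h
    · exfalso; apply hbb'
      have e := norm_sub_sq_real B B'
      rw [hB, hB', h] at e
      have : ‖B - B'‖ = 0 := by nlinarith [norm_nonneg (B - B')]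
      have hBB' : B = B' := by rwa [norm_eq_zero, sub_eq_zero] at this
      have := congrArg (· + u) hBB'
      simpa [hBd, hB'd] using this
    · exact h
  have hγ : ⟪C, C'⟫_ℝ = -1 / 3 := by
    rcases inner_eq_one_or_eq_neg_third hA hC hB hC' hAC hAB hAC'
      (by rw [real_inner_comm]; exact hBC) (by rw [real_inner_comm]; exact hBC') with h | h
    · exfalso; apply hcc'
      have e := norm_sub_sq_real C C'
      rw [hC, hC', h] at e
      have : ‖C - C'‖ = 0 := by nlinarith [norm_nonneg (C - C')]
      have hCC' : C = C' := by rwa [norm_eq_zero, sub_eq_zero] at this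
      have := congrArg (· + u) hCC'
      simpa [hCd, hC'd] using this
    · exact h
  -- the vector `B + B' − C − C'` would have negative squared norm
  have hBB : ⟪B, B⟫_ℝ = 1 := by rw [real_inner_self_eq_norm_sq, hB]; norm_num
  have hCC : ⟪C, C⟫_ℝ = 1 := by rw [real_inner_self_eq_norm_sq, hC]; norm_num
  have hB'B' : ⟪B', B'⟫_ℝ = 1 := by rw [real_inner_self_eq_norm_sq, hB']; norm_num
  have hC'C' : ⟪C', C'⟫_ℝ = 1 := by rw [real_inner_self_eq_norm_sq, hC']; norm_num
  have hnn : 0 ≤ ⟪B + B' - C - C', B + B' - C - C'⟫_ℝ := real_inner_self_nonneg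
  simp only [inner_add_left, inner_add_right, inner_sub_left, inner_sub_right] at hnn
  rw [real_inner_comm B B', real_inner_comm B C, real_inner_comm B' C, real_inner_comm B C',
    real_inner_comm B' C', real_inner_comm C C'] at hnn
  linarith

end Summit.Ventures.Crystal3D.Theorems

end
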